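import Literature.MathematicalPhysics.KineticTheory.HardSphereUniformGas
import HarnessLib

/-!
# Line `Sketch` of crux `RateFloor`, rung 0: the deterministic lemmas of the static floor assembly
# (helper file, `--supports stmt-AtomisticToContinuum-13080`)

Three elementary inputs of the assembly `stub_staticOpacityFloorRung0 ⇐ Plateau′` (c2 lane):

* `sum_ge_of_few_bad` — FINITARY: if the nonnegative window values `W_k` fail their floors `m_k − t` on fewer than `fK`
  windows and `m_k ≤ m̄`, then `Σ_k W_k ≥ Σ_k m_k − K t − f K m̄`;
* `exists_modulus_flight` — a modulus of continuity of a continuous weight `χ` on `[0, τ] × 𝕋³` along short free flights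
  of slow particles: `|χ(s + t₁, y + t₁ v) − χ(s, y)| ≤ ω` for `0 ≤ t₁ ≤ ϑ`, `‖v‖ ≤ R` (uniform continuity on a compact set
  of the map `(s, y, t₁, v) ↦ χ(s + t₁, y + t₁ v)`, which is `χ(s, y)` at `t₁ = 0`; no metric on the torus is used);
* `integral_le_riemann_add` — the RIEMANN bound `∫₀^τ ∫ χ ≤ Δ Σ_{k<⌊τ/Δ⌋} ∫ χ(kΔ, ·) + τ ω + Δ Cχ` for a weight with time
  modulus `ω` at scale `Δ` and bound `Cχ` on `[0, τ]`.
-/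

noncomputable section

open MeasureTheory Set Filter Topology Function intervalIntegral
open scoped BigOperators

namespace Summit.AtomisticToContinuum.HydrodynamicLimit.Theorems

namespace RateFloorStaticFloor

open Literature.Analysis.FluidPDE Literature.MathematicalPhysics.KineticTheory

/-! ## Few bad windows -/

/-- **Few bad windows give the summed floor**: `W_k ≥ 0`, `m_k ≤ m̄`, `0 ≤ t`, `0 ≤ m̄`, and fewer than `fK` indices with
`W_k ≤ m_k − t` imply `Σ m_k − K t − f K m̄ ≤ Σ W_k`. [folklore] -/
theorem sum_ge_of_few_bad {K : ℕ} {W m : Fin K → ℝ} {mbar t f : ℝ} (hW : ∀ k, 0 ≤ W k) (hm : ∀ k, m k ≤ mbar)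
    (ht : 0 ≤ t) (hmbar : 0 ≤ mbar)
    (hbad : (∑ k, if W k ≤ m k - t then (1 : ℝ) else 0) < f * K) :
    (∑ k, m k) - K * t - f * K * mbar ≤ ∑ k, W k := by
  have hk : ∀ k, m k - t - mbar * (if W k ≤ m k - t then (1 : ℝ) else 0) ≤ W k := fun k => by
    split_ifs with h
    · have := hm k; have := hW k; linarith
    · push Not at h; linarith
  have hsum := Finset.sum_le_sum fun k (_ : k ∈ Finset.univ) => hk k
  rw [Finset.sum_sub_distrib, Finset.sum_sub_distrib, ← Finset.mul_sum, Finset.sum_const, Finset.card_univ,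
    Fintype.card_fin, nsmul_eq_mul] at hsum
  have hb := mul_le_mul_of_nonneg_left hbad.le hmbar
  linarith

/-! ## A modulus of continuity along short flights -/

/-- **Modulus of continuity of the weight along short free flights of slow particles**: for `χ` continuous on
`ℝ × 𝕋³`, `ω > 0`, there is `ϑ ∈ (0, 1]` with `|χ(s + t₁, y + t₁ v) − χ(s, y)| ≤ ω` whenever `s ∈ [0, τ]`,
`0 ≤ t₁ ≤ ϑ`, `‖v‖ ≤ R` (in particular, with `v = 0`, a modulus in time). [folklore] -/
theorem exists_modulus_flight {χ : ℝ × T3 → ℝ} (hχ : Continuous χ) (τ R : ℝ) {ω : ℝ} (hω : 0 < ω) :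
    ∃ ϑ : ℝ, 0 < ϑ ∧ ϑ ≤ 1 ∧ ∀ s ∈ Icc (0 : ℝ) τ, ∀ (y : T3) (t₁ : ℝ), 0 ≤ t₁ → t₁ ≤ ϑ → ∀ v : V3, ‖v‖ ≤ R →
      |χ (s + t₁, (Torus.geometry (Fin 3)).translate y (t₁ • v)) - χ (s, y)| ≤ ω := by
  set G := Torus.geometry (Fin 3) with hG
  -- the map `(s, y, t₁, v) ↦ χ(s + t₁, y + t₁ v)`
  set g : ℝ × T3 × ℝ × V3 → ℝ := fun p => χ (p.1 + p.2.2.1, G.translate p.2.1 (p.2.2.1 • p.2.2.2)) with hg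
  have htr : Continuous fun q : T3 × V3 => G.translate q.1 q.2 := by
    simp only [hG, Torus.geometry_translate]
    exact continuous_fst.add (Literature.Analysis.FunctionSpaces.Torus.continuous_proj.comp continuous_snd)
  have hgc : Continuous g := by
    refine hχ.comp (Continuous.prodMk (by fun_prop) ?_)
    exact htr.comp ((continuous_fst.comp continuous_snd).prodMk
      ((continuous_fst.comp (continuous_snd.comp continuous_snd)).smul (continuous_snd.comp (continuous_snd.comp continuous_snd))))
  set Kset : Set (ℝ × T3 × ℝ × V3) := Icc (0 : ℝ) τ ×ˢ ((univ : Set T3) ×ˢ (Icc (0 : ℝ) 1 ×ˢ Metric.closedBall (0 : V3) R))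
    with hK
  have hKc : IsCompact Kset :=
    isCompact_Icc.prod (isCompact_univ.prod (isCompact_Icc.prod (isCompact_closedBall _ _)))
  have hUC := Metric.uniformContinuousOn_iff.1 (hKc.uniformContinuousOn_of_continuous hgc.continuousOn)
  obtain ⟨δ, hδ, hU⟩ := hUC ω hω
  refine ⟨min (δ / 2) 1, by positivity, min_le_right _ _, fun s hs y t₁ ht0 ht1 v hv => ?_⟩
  have ht1' : t₁ ≤ 1 := ht1.trans (min_le_right _ _)
  have htδ : t₁ < δ := lt_of_le_of_lt (ht1.trans (min_le_left _ _)) (by linarith)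
  have hp : ((s, y, t₁, v) : ℝ × T3 × ℝ × V3) ∈ Kset := by
    simp only [hK, mem_prod, mem_univ, true_and, mem_Icc, Metric.mem_closedBall, dist_zero_right]
    exact ⟨hs, ⟨ht0, ht1'⟩, hv⟩
  have hp0 : ((s, y, (0 : ℝ), v) : ℝ × T3 × ℝ × V3) ∈ Kset := by
    simp only [hK, mem_prod, mem_univ, true_and, mem_Icc, Metric.mem_closedBall, dist_zero_right]
    exact ⟨hs, ⟨le_rfl, zero_le_one⟩, hv⟩
  have hdist : dist ((s, y, t₁, v) : ℝ × T3 × ℝ × V3) (s, y, (0 : ℝ), v) < δ := by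
    rw [Prod.dist_eq, Prod.dist_eq, Prod.dist_eq, dist_self, dist_self, dist_self, Real.dist_eq, sub_zero, abs_of_nonneg ht0]
    simp only [max_lt_iff]
    exact ⟨hδ, hδ, htδ, hδ⟩
  have h := hU _ hp _ hp0 hdist
  rw [Real.dist_eq] at h
  have e0 : g (s, y, (0 : ℝ), v) = χ (s, y) := by
    simp only [hg, add_zero, zero_smul, G.translate_zero]
  have e1 : g (s, y, t₁, v) = χ (s + t₁, G.translate y (t₁ • v)) := rfl
  rw [e0, e1] at h
  exact h.le

/-! ## The Riemann bound for the time integral of the weight -/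

/-- The spatial integral `s ↦ ∫ χ(s, x) dx` of a continuous weight is continuous. [folklore] -/
theorem continuous_integral_torus {χ : ℝ × T3 → ℝ} (hχ : Continuous χ) : Continuous fun s : ℝ => ∫ x : T3, χ (s, x) := by
  have h := continuous_parametric_integral_of_continuous (μ := (volume : Measure T3)) (f := fun (s : ℝ) (x : T3) => χ (s, x))
    hχ isCompact_univ
  simpa only [Measure.restrict_univ] using h

/-- **Riemann bound**: for a continuous weight `χ ≥ 0` with `χ ≤ Cχ` on `[0, τ] × 𝕋³` and time modulus `ω` at scale `Δ`
on `[0, τ]` (`0 < Δ`),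
`∫_{[0,τ]} ∫ χ ≤ Δ Σ_{k < ⌊τ/Δ⌋₊} ∫ χ(kΔ, ·) + τ ω + Δ Cχ`. [folklore] -/
theorem integral_le_riemann_add {χ : ℝ × T3 → ℝ} (hχ : Continuous χ) (hχ0 : ∀ p, 0 ≤ χ p) {τ Cχ : ℝ} (hτ : 0 < τ)
    (hχC : ∀ s ∈ Icc (0 : ℝ) τ, ∀ x : T3, χ (s, x) ≤ Cχ) {Δ ω : ℝ} (hΔ : 0 < Δ) (hω : 0 ≤ ω)
    (hmodt : ∀ s ∈ Icc (0 : ℝ) τ, ∀ s' ∈ Icc (0 : ℝ) τ, |s - s'| ≤ Δ → ∀ x : T3, |χ (s, x) - χ (s', x)| ≤ ω) :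
    (∫ s in Icc (0 : ℝ) τ, ∫ x : T3, χ (s, x)) ≤
      Δ * (∑ k ∈ Finset.range ⌊τ / Δ⌋₊, ∫ x : T3, χ (k * Δ, x)) + τ * ω + Δ * Cχ := by
  set K := ⌊τ / Δ⌋₊ with hKdef
  set g : ℝ → ℝ := fun s => ∫ x : T3, χ (s, x) with hg
  have hgc : Continuous g := continuous_integral_torus hχ
  have hii : ∀ a b : ℝ, IntervalIntegrable g volume a b := fun a b => hgc.intervalIntegrable a b
  -- `K Δ ≤ τ < (K + 1) Δ`
  have hKΔ : (K : ℝ) * Δ ≤ τ := by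
    have h := Nat.floor_le (div_nonneg hτ.le hΔ.le)
    rw [← hKdef] at h
    calc (K : ℝ) * Δ ≤ τ / Δ * Δ := mul_le_mul_of_nonneg_right h hΔ.le
      _ = τ := div_mul_cancel₀ τ hΔ.ne'
  have hτK : τ - K * Δ ≤ Δ := by
    have h := Nat.lt_floor_add_one (τ / Δ)
    rw [← hKdef] at h
    have : τ < (K + 1) * Δ := by
      calc τ = τ / Δ * Δ := (div_mul_cancel₀ τ hΔ.ne').symm
        _ < (K + 1) * Δ := mul_lt_mul_of_pos_right h hΔ
    linarith
  -- pointwise facts on `g`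
  have hg0 : ∀ s, 0 ≤ g s := fun s => integral_nonneg fun x => hχ0 _
  have hgC : ∀ s ∈ Icc (0 : ℝ) τ, g s ≤ Cχ := fun s hs => by
    calc g s ≤ ∫ _x : T3, Cχ := integral_mono_of_nonneg (ae_of_all _ fun x => hχ0 _) (integrable_const _) (ae_of_all _ fun x => hχC s hs x)
      _ = Cχ := by rw [MeasureTheory.integral_const, probReal_univ, one_smul]
  have hint : ∀ r : ℝ, Integrable (fun x : T3 => χ (r, x)) := fun r =>
    integrableOn_univ.mp (((hχ.comp (Continuous.prodMk_right r)).continuousOn).integrableOn_compact isCompact_univ)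
  have hgmod : ∀ s ∈ Icc (0 : ℝ) τ, ∀ s' ∈ Icc (0 : ℝ) τ, |s - s'| ≤ Δ → g s ≤ g s' + ω := fun s hs s' hs' hss' => by
    have hsub : g s - g s' = ∫ x : T3, (χ (s, x) - χ (s', x)) := (integral_sub (hint s) (hint s')).symm
    have hle : ∫ x : T3, (χ (s, x) - χ (s', x)) ≤ ∫ _x : T3, ω :=
      integral_mono ((hint s).sub (hint s')) (integrable_const ω) fun x => (le_abs_self _).trans (hmodt s hs s' hs' hss' x)
    rw [MeasureTheory.integral_const, probReal_univ, one_smul] at hle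
    linarith
  have hCχ0 : 0 ≤ Cχ := (hχ0 _).trans (hχC 0 ⟨le_rfl, hτ.le⟩ 0)
  -- interval-integral form and splitting at `K Δ`
  have h0 : (∫ s in Icc (0 : ℝ) τ, g s) = ∫ s in (0 : ℝ)..τ, g s := by
    rw [intervalIntegral.integral_of_le hτ.le, integral_Icc_eq_integral_Ioc]
  have hsplit : (∫ s in (0 : ℝ)..τ, g s) = (∫ s in (0 : ℝ)..(K * Δ), g s) + ∫ s in (K * Δ : ℝ)..τ, g s :=
    (integral_add_adjacent_intervals (hii 0 (K * Δ)) (hii (K * Δ) τ)).symm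
  have hsum : ∑ k ∈ Finset.range K, ∫ s in ((k : ℕ) : ℝ) * Δ..((k + 1 : ℕ) : ℝ) * Δ, g s = ∫ s in (0 : ℝ)..(K * Δ), g s := by
    have h := sum_integral_adjacent_intervals (μ := volume) (f := g) (a := fun k : ℕ => (k : ℝ) * Δ) (n := K)
      (fun k _ => hii _ _)
    simpa only [Nat.cast_zero, zero_mul] using h
  -- each window
  have hwin : ∀ k ∈ Finset.range K, ∫ s in ((k : ℕ) : ℝ) * Δ..((k + 1 : ℕ) : ℝ) * Δ, g s ≤ Δ * (g (k * Δ) + ω) := by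
    intro k hk
    have hkK : (k : ℝ) + 1 ≤ K := by exact_mod_cast Nat.succ_le_of_lt (Finset.mem_range.1 hk)
    have hk0 : 0 ≤ (k : ℝ) * Δ := mul_nonneg (Nat.cast_nonneg _) hΔ.le
    have hab : (k : ℝ) * Δ ≤ ((k + 1 : ℕ) : ℝ) * Δ := by
      push_cast; nlinarith
    have hk1τ : ((k + 1 : ℕ) : ℝ) * Δ ≤ τ := by
      push_cast
      calc ((k : ℝ) + 1) * Δ ≤ K * Δ := mul_le_mul_of_nonneg_right hkK hΔ.le
        _ ≤ τ := hKΔ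
    have hkτ : (k : ℝ) * Δ ≤ τ := hab.trans hk1τ
    have hmono : ∫ s in ((k : ℕ) : ℝ) * Δ..((k + 1 : ℕ) : ℝ) * Δ, g s ≤
        ∫ _s in ((k : ℕ) : ℝ) * Δ..((k + 1 : ℕ) : ℝ) * Δ, (g (k * Δ) + ω) := by
      refine intervalIntegral.integral_mono_on hab (hii _ _) intervalIntegrable_const fun x hx => ?_
      have hxτ : x ∈ Icc (0 : ℝ) τ := ⟨hk0.trans hx.1, hx.2.trans hk1τ⟩
      have hxk : |x - k * Δ| ≤ Δ := by
        rw [abs_of_nonneg (by linarith [hx.1])]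
        have := hx.2; push_cast at this; linarith
      exact hgmod x hxτ (k * Δ) ⟨hk0, hkτ⟩ hxk
    rw [intervalIntegral.integral_const, smul_eq_mul] at hmono
    calc ∫ s in ((k : ℕ) : ℝ) * Δ..((k + 1 : ℕ) : ℝ) * Δ, g s ≤ (((k + 1 : ℕ) : ℝ) * Δ - k * Δ) * (g (k * Δ) + ω) := hmono
      _ = Δ * (g (k * Δ) + ω) := by push_cast; ring
  -- the tail
  have htail : ∫ s in (K * Δ : ℝ)..τ, g s ≤ Δ * Cχ := by
    have hmono : ∫ s in (K * Δ : ℝ)..τ, g s ≤ ∫ _s in (K * Δ : ℝ)..τ, Cχ := by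
      refine intervalIntegral.integral_mono_on hKΔ (hii _ _) intervalIntegrable_const fun x hx => ?_
      exact hgC x ⟨(mul_nonneg (Nat.cast_nonneg _) hΔ.le).trans hx.1, hx.2⟩
    rw [intervalIntegral.integral_const, smul_eq_mul] at hmono
    exact hmono.trans (mul_le_mul_of_nonneg_right hτK hCχ0)
  -- assemble
  have hwsum : ∑ k ∈ Finset.range K, ∫ s in ((k : ℕ) : ℝ) * Δ..((k + 1 : ℕ) : ℝ) * Δ, g s ≤
      Δ * (∑ k ∈ Finset.range K, g (k * Δ)) + τ * ω := by
    calc ∑ k ∈ Finset.range K, ∫ s in ((k : ℕ) : ℝ) * Δ..((k + 1 : ℕ) : ℝ) * Δ, g s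
        ≤ ∑ k ∈ Finset.range K, Δ * (g (k * Δ) + ω) := Finset.sum_le_sum hwin
      _ = Δ * (∑ k ∈ Finset.range K, g (k * Δ)) + (K * Δ) * ω := by
          rw [← Finset.mul_sum, Finset.sum_add_distrib, Finset.sum_const, Finset.card_range, nsmul_eq_mul]; ring
      _ ≤ Δ * (∑ k ∈ Finset.range K, g (k * Δ)) + τ * ω := by
          have := mul_le_mul_of_nonneg_right hKΔ hω
          linarith
  rw [h0, hsplit, ← hsum]
  linarith [hwsum, htail]

/-- Registered stub `stub_sumGeOfFewBadRung0` of crux stmt-AtomisticToContinuum-13080 (line `Sketch`, c2 lane): the closed form of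
`sum_ge_of_few_bad`. -/
theorem stub_sumGeOfFewBadRung0 : ∀ (K : ℕ) (W m : Fin K → ℝ) (mbar t f : ℝ), (∀ k, 0 ≤ W k) → (∀ k, m k ≤ mbar) → 0 ≤ t → 0 ≤ mbar → (∑ k, if W k ≤ m k - t then (1 : ℝ) else 0) < f * K → (∑ k, m k) - K * t - f * K * mbar ≤ ∑ k, W k :=
  fun _K _W _m _mbar _t _f hW hm ht hmbar hbad => sum_ge_of_few_bad hW hm ht hmbar hbad

end RateFloorStaticFloor

end Summit.AtomisticToContinuum.HydrodynamicLimit.Theorems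

end
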